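import Mathlib
import Summits.PneNP.PneNP.Theses.OverlapGapAlgebra
import Summits.PneNP.PneNP.Theorems.OverlapGapAlgebraSolvableImpliesStableSectionDensityLiftCount
import Summits.PneNP.PneNP.Theorems.OverlapGapAlgebraSolvableImpliesStableSectionUnitClauseCore

/-!
# PneNP / OverlapGapAlgebra — crux `SolvableImpliesStableSection` (stmt-PneNP-2463):
# the DENSITY LIFT block (4/4) — the conclusion is monotone upward in the density; the new core

Support for crux `stmt-PneNP-2463` (`Summit.PneNP.PneNP.Theses.OverlapGapAlgebra.SolvableImpliesStableSection`).
THE RESULT OF THE BLOCK.  The f-free CONCLUSION of the crux (a `νm`-valid, `ηn`-stable section along the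
Bresler–Huang path on `≥ e^{-cn}·#paths`, for every `c > 0`, for all large `n`) at `(k, α', η, ν')`
implies the conclusion at `(k, α, η, ν)` for every larger density `α > α'` and every
`ν > ν'·α'/α + 2^{-k}(1 - α'/α)` (`sissDL_transfer`): lift a good section from the first `⌊α' n⌋`
clauses (`sissDL_count`); the ignored clauses are violated at the trivial rate `2^{-k}`.  With the
unit-clause block (`sissU_conclusion_of_threshold`: every `ν > 0` below the Chao–Franco threshold
`α_UC(k) = 2^k/((k²-k)·2M_k)`, `M_k = (k-2)^{k-2}/(k-1)^{k-1}`) this gives the conclusion at EVERY density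
for every `ν > 2^{-k}(1 - α_UC(k)/α)` (`sissDL_conclusion`) — an edge below both earlier all-density
edges `2^{-k}(1 - e^{-kα2^{-k}}/2)` (`sissF_conclusion`) and `2^{-k}(e^{kα2^{-k}} - 1)` at every
`α ≥ α_UC(k)` — and shrinks the core of the crux (`sissDL_solvableImpliesStableSection_iff_core`): the
crux is equivalent to its restriction to `{α ≥ α_UC(k)} ∩ {α < 2^k log 2} ∩ {η < 1} ∩
{ν ≤ 2^{-k}(1 - α_UC(k)/α)}`.  Moral: inside the satisfiable phase the only remaining lever on the
f-free side is the all-`ν` threshold itself (child M of line `RegimeSplit`).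

* `sissDL_transfer` — upward density transfer of the conclusion (eventual form);
* `sissDL_conclusion` — the conclusion above the truncation level `2^{-k}(1 - α_UC(k)/α)`;
* `sissDL_solvableImpliesStableSection_off_core`, `sissDL_solvableImpliesStableSection_iff_core`.
No new definitions; axioms `propext`, `Classical.choice`, `Quot.sound`.
-/

set_option linter.dupNamespace false -- `Summit.PneNP.PneNP.…`: summit = sub-problem (D-0017)

namespace Summit.PneNP.PneNP.Theorems

open Finset Filter
open scoped Classical

section DensityLiftAssembly

/-- **Upward density transfer of the conclusion.** For every `k`, `0 < α' < α`, `η > 0`, `ν' ≥ 0` and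
`ν` with `ν'α' + 2^{-k}(α - α') < να`: if for every `c' > 0`, for all large `n` (`m' = ⌊α' n⌋₊`), some map on
`m'`-clause instances is `ν'm'`-valid at every splice point of the Bresler–Huang path and `ηn`-stable
between consecutive splice points on `≥ e^{-c'n}·#paths'`, then for every `c > 0`, for all large `n`
(`m = ⌊α n⌋₊`), some map on `m`-clause instances (the lift of such a map from the first `m'` clauses)
is `νm`-valid and `ηn`-stable in the same sense on `≥ e^{-cn}·#paths`. -/
theorem sissDL_transfer (k : ℕ) (α' α η ν' ν : ℝ) (hα' : 0 < α') (hαα : α' < α) (hη : 0 < η)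
    (hν' : 0 ≤ ν') (hν : ν' * α' + (1 / 2 : ℝ) ^ k * (α - α') < ν * α)
    (hC : ∀ c' : ℝ, 0 < c' → ∀ᶠ n : ℕ in atTop, ∀ m' : ℕ, m' = ⌊α' * n⌋₊ →
      ∃ G : (Fin m' → Fin k → Fin n × Bool) → (Fin n → Bool),
        Real.exp (-(c' * n)) * Fintype.card (Fin (k + 1) → Fin m' → Fin k → Fin n × Bool) ≤
        ((Finset.univ.filter fun Ψ : Fin (k + 1) → Fin m' → Fin k → Fin n × Bool =>
          let P : Fin k → ℕ → Fin m' → Fin k → Fin n × Bool :=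
            fun r q a b => if (a : ℕ) * k + b < q then Ψ r.succ a b else Ψ r.castSucc a b
          (∀ r : Fin k, ∀ q ≤ m' * k, ((Finset.univ.filter fun i : Fin m' =>
            ∀ j, G (P r q) (P r q i j).1 ≠ (P r q i j).2).card : ℝ) ≤ ν' * m') ∧
          ∀ r : Fin k, ∀ q < m' * k,
            (hammingDist (G (P r q)) (G (P r (q + 1))) : ℝ) ≤ η * n).card : ℝ))
    (c : ℝ) (hc : 0 < c) :
    ∀ᶠ n : ℕ in atTop, ∀ m : ℕ, m = ⌊α * n⌋₊ →
      ∃ g : (Fin m → Fin k → Fin n × Bool) → (Fin n → Bool),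
        Real.exp (-(c * n)) * Fintype.card (Fin (k + 1) → Fin m → Fin k → Fin n × Bool) ≤
        ((Finset.univ.filter fun Ψ : Fin (k + 1) → Fin m → Fin k → Fin n × Bool =>
          let P : Fin k → ℕ → Fin m → Fin k → Fin n × Bool :=
            fun r q a b => if (a : ℕ) * k + b < q then Ψ r.succ a b else Ψ r.castSucc a b
          (∀ r : Fin k, ∀ q ≤ m * k, ((Finset.univ.filter fun i : Fin m =>
            ∀ j, g (P r q) (P r q i j).1 ≠ (P r q i j).2).card : ℝ) ≤ ν * m) ∧
          ∀ r : Fin k, ∀ q < m * k,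
            (hammingDist (g (P r q)) (g (P r (q + 1))) : ℝ) ≤ η * n).card : ℝ) := by
  have hα : 0 < α := hα'.trans hαα
  set p : ℝ := (1 / 2 : ℝ) ^ k with hp
  have hp0 : 0 < p := by rw [hp]; positivity
  have hν0 : 0 < ν := by
    have h1 : 0 ≤ ν' * α' + p * (α - α') := by
      have : 0 ≤ α - α' := by linarith
      positivity
    have h2 : 0 < ν * α := lt_of_le_of_lt h1 hν
    by_contra h
    push Not at h
    have : ν * α ≤ 0 := mul_nonpos_of_nonpos_of_nonneg h hα.le
    linarith
  -- the constants
  obtain ⟨τ, hτ⟩ : ∃ τ : ℝ, τ = (ν * α - (ν' * α' + p * (α - α'))) / 2 := ⟨_, rfl⟩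
  have hτ0 : 0 < τ := by rw [hτ]; linarith
  have hkey : ν * α - ν' * α' - p * (α - α') = 2 * τ := by rw [hτ]; ring
  obtain ⟨κ, hκ⟩ : ∃ κ : ℝ, κ = τ ^ 2 / (2 * (α - α' + 1)) := ⟨_, rfl⟩
  have hA0 : 0 < α - α' + 1 := by linarith
  have hκ0 : 0 < κ := by rw [hκ]; positivity
  obtain ⟨c₁, hc₁⟩ : ∃ c₁ : ℝ, c₁ = min c κ / 2 := ⟨_, rfl⟩
  have hc₁0 : 0 < c₁ := by rw [hc₁]; positivity
  have hc₁c : c₁ < c := by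
    rw [hc₁]; have := min_le_left c κ; linarith
  have hc₁κ : c₁ < κ := by
    rw [hc₁]; have := min_le_right c κ; linarith
  obtain ⟨b, hb⟩ : ∃ b : ℝ, b = κ - c₁ := ⟨_, rfl⟩
  have hb0 : 0 < b := by rw [hb]; linarith
  -- eventual facts
  have E0 : ∀ᶠ n : ℕ in atTop, 1 ≤ n := eventually_ge_atTop 1
  have E1 : ∀ᶠ n : ℕ in atTop, (1 + p + ν) / τ ≤ (n : ℝ) :=
    tendsto_natCast_atTop_atTop.eventually_ge_atTop _
  have E2 : ∀ᶠ n : ℕ in atTop, 1 / (α - α') ≤ (n : ℝ) :=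
    tendsto_natCast_atTop_atTop.eventually_ge_atTop _
  have E3 : ∀ᶠ n : ℕ in atTop, 4 * k * (α * k + 1) / b ^ 2 ≤ (n : ℝ) :=
    tendsto_natCast_atTop_atTop.eventually_ge_atTop _
  have E4 : ∀ᶠ n : ℕ in atTop, 1 / (c - c₁) ≤ (n : ℝ) :=
    tendsto_natCast_atTop_atTop.eventually_ge_atTop _
  filter_upwards [hC c₁ hc₁0, E0, E1, E2, E3, E4] with n hCn hn1 hE1 hE2 hE3 hE4 m hm
  have hnR : (1 : ℝ) ≤ n := by exact_mod_cast hn1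
  have hn0 : (0 : ℝ) < n := by linarith
  -- the two instance sizes
  obtain ⟨m', hm'⟩ : ∃ m' : ℕ, m' = ⌊α' * n⌋₊ := ⟨_, rfl⟩
  obtain ⟨G, hG⟩ := hCn m' hm'
  have hE1' : 1 + p + ν ≤ τ * n := by
    rw [mul_comm]; exact (div_le_iff₀ hτ0).1 hE1
  have hE2' : α' * n + 1 ≤ α * n := by
    have hαα' : 0 < α - α' := by linarith
    have h1 : 1 ≤ (α - α') * n := by rw [mul_comm]; exact (div_le_iff₀ hαα').1 hE2
    calc α' * n + 1 ≤ α' * n + (α - α') * n := by linarith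
      _ = α * n := by ring
  have hE4' : 1 ≤ (c - c₁) * n := by
    have hcc : 0 < c - c₁ := by linarith
    rw [mul_comm]; exact (div_le_iff₀ hcc).1 hE4
  have hmm' : m' ≤ m := by
    rw [hm, hm']
    exact Nat.floor_le_floor (mul_le_mul_of_nonneg_right hαα.le hn0.le)
  have hmR : (m : ℝ) ≤ α * n := by rw [hm]; exact Nat.floor_le (by positivity)
  have hmR' : α * n - 1 ≤ (m : ℝ) := by
    rw [hm]; have := Nat.lt_floor_add_one (α * n); linarith
  have hm'R : (m' : ℝ) ≤ α' * n := by rw [hm']; exact Nat.floor_le (by positivity)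
  have hm'R' : α' * n - 1 ≤ (m' : ℝ) := by
    rw [hm']; have := Nat.lt_floor_add_one (α' * n); linarith
  have hdR : ((m - m' : ℕ) : ℝ) = (m : ℝ) - m' := Nat.cast_sub hmm'
  have hd1 : (1 : ℝ) ≤ ((m - m' : ℕ) : ℝ) := by
    have h1 : m' + 1 ≤ m := by
      rw [hm, hm', ← Nat.floor_add_one (by positivity : (0 : ℝ) ≤ α' * n)]
      exact Nat.floor_le_floor hE2'
    have : ((m' + 1 : ℕ) : ℝ) ≤ m := by exact_mod_cast h1
    push_cast at this
    rw [hdR]; linarith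
  have hd2 : ((m - m' : ℕ) : ℝ) ≤ (α - α' + 1) * n := by
    rw [hdR]
    calc (m : ℝ) - m' ≤ α * n - (α' * n - 1) := by linarith
      _ = (α - α') * n + 1 := by ring
      _ ≤ (α - α') * n + n := by linarith
      _ = (α - α' + 1) * n := by ring
  -- `n^k/(2n)^k = 2^{-k}`
  have hpn : (n : ℝ) ^ k / (2 * (n : ℝ)) ^ k = p := by
    rw [hp, ← div_pow]
    congr 1
    field_simp
  -- the validity threshold
  have hV : ν' * m' + 1 + (n : ℝ) ^ k / (2 * (n : ℝ)) ^ k * ((m - m' : ℕ) : ℝ) + τ * n ≤ ν * m := by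
    rw [hpn]
    have h1 : ν' * (m' : ℝ) ≤ ν' * α' * n := by
      rw [mul_assoc]; exact mul_le_mul_of_nonneg_left hm'R hν'
    have h2 : p * ((m - m' : ℕ) : ℝ) ≤ p * (α - α') * n + p := by
      have : ((m - m' : ℕ) : ℝ) ≤ (α - α') * n + 1 := by rw [hdR]; linarith
      have := mul_le_mul_of_nonneg_left this hp0.le
      linarith [this]
    have h3 : ν * α * n - ν ≤ ν * m := by
      have := mul_le_mul_of_nonneg_left hmR' hν0.le
      linarith [this]
    have hkey' : ν * α * n - ν' * α' * n - p * (α - α') * n = 2 * (τ * n) := by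
      calc ν * α * n - ν' * α' * n - p * (α - α') * n = (ν * α - ν' * α' - p * (α - α')) * n := by ring
        _ = 2 * τ * n := by rw [hkey]
        _ = 2 * (τ * n) := by ring
    linarith
  -- the count
  have hcount := sissDL_count hmm' hn1 (ν' * m') (ν * m) (η * n) (τ * n) (Real.exp (-(c₁ * n)))
    (by positivity) (by positivity) hV G (fun Φ => G (fun a' => Φ (Fin.castLE hmm' a')))
    (fun _ => rfl) hG
  refine ⟨fun Φ => G (fun a' => Φ (Fin.castLE hmm' a')), le_trans ?_ hcount⟩
  refine mul_le_mul_of_nonneg_right ?_ (Nat.cast_nonneg _)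
  -- `e^{-cn} ≤ e^{-c₁n} - k(mk+1)e^{-t²/(2(m-m'))}`
  have hexp1 : 2 * Real.exp (-(c * n)) ≤ Real.exp (-(c₁ * n)) := by
    have h1 : (2 : ℝ) ≤ Real.exp ((c - c₁) * n) := by
      have := Real.add_one_le_exp ((c - c₁) * n); linarith
    have h2 : Real.exp (-(c₁ * n)) = Real.exp ((c - c₁) * n) * Real.exp (-(c * n)) := by
      rw [← Real.exp_add]; congr 1; ring
    rw [h2]
    exact mul_le_mul_of_nonneg_right h1 (Real.exp_pos _).le
  have htail : (k : ℝ) * (m * k + 1) * Real.exp (-((τ * n) ^ 2 / (2 * ((m - m' : ℕ) : ℝ)))) ≤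
      Real.exp (-(c₁ * n)) / 2 := by
    -- (i) the exponent
    have hd0 : (0 : ℝ) < ((m - m' : ℕ) : ℝ) := by linarith
    have hi : κ * n ≤ (τ * n) ^ 2 / (2 * ((m - m' : ℕ) : ℝ)) := by
      rw [hκ, le_div_iff₀ (by positivity)]
      calc τ ^ 2 / (2 * (α - α' + 1)) * n * (2 * ((m - m' : ℕ) : ℝ))
          = τ ^ 2 * n * (((m - m' : ℕ) : ℝ) / (α - α' + 1)) := by
            field_simp
        _ ≤ τ ^ 2 * n * n := by
            refine mul_le_mul_of_nonneg_left ?_ (by positivity)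
            rw [div_le_iff₀ hA0]; linarith
        _ = (τ * n) ^ 2 := by ring
    have hii : Real.exp (-((τ * n) ^ 2 / (2 * ((m - m' : ℕ) : ℝ)))) ≤ Real.exp (-(κ * n)) :=
      Real.exp_le_exp.2 (neg_le_neg hi)
    -- (ii) the polynomial factor
    have hk0 : (0 : ℝ) ≤ k := Nat.cast_nonneg _
    have hiii : (k : ℝ) * (m * k + 1) ≤ k * (α * k * n + 1) := by
      have h1 : (m : ℝ) * k ≤ α * n * k := mul_le_mul_of_nonneg_right hmR hk0
      calc (k : ℝ) * (m * k + 1) ≤ k * (α * n * k + 1) := mul_le_mul_of_nonneg_left (by linarith) hk0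
        _ = k * (α * k * n + 1) := by ring
    -- (iii) the decay: `2k(αkn+1) e^{-bn} ≤ 1`
    have hiv : 2 * ((k : ℝ) * (α * k * n + 1)) * Real.exp (-(b * n)) ≤ 1 := by
      have h1 : 2 * ((k : ℝ) * (α * k * n + 1)) ≤ 2 * k * (α * k + 1) * n := by
        have h11 : α * k * n + 1 ≤ α * k * n + n := by linarith
        calc 2 * ((k : ℝ) * (α * k * n + 1)) ≤ 2 * ((k : ℝ) * (α * k * n + n)) :=
              mul_le_mul_of_nonneg_left (mul_le_mul_of_nonneg_left h11 hk0) (by norm_num)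
          _ = 2 * k * (α * k + 1) * n := by ring
      have h2 : 2 * (k : ℝ) * (α * k + 1) * n ≤ (b * n) ^ 2 / 2 := by
        have h21 : 4 * k * (α * k + 1) ≤ (n : ℝ) * b ^ 2 :=
          (div_le_iff₀ (by positivity : (0 : ℝ) < b ^ 2)).1 hE3
        have h22 := mul_le_mul_of_nonneg_right h21 hn0.le
        calc 2 * (k : ℝ) * (α * k + 1) * n = 4 * k * (α * k + 1) * n / 2 := by ring
          _ ≤ (n : ℝ) * b ^ 2 * n / 2 := div_le_div_of_nonneg_right h22 (by norm_num)
          _ = (b * n) ^ 2 / 2 := by ring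
      have h3 : (b * n) ^ 2 / 2 ≤ Real.exp (b * n) := by
        have := Real.pow_div_factorial_le_exp (b * n) (by positivity) 2
        simpa [Nat.factorial] using this
      have h4 : 2 * ((k : ℝ) * (α * k * n + 1)) ≤ Real.exp (b * n) := by linarith
      have h5 : Real.exp (b * n) * Real.exp (-(b * n)) = 1 := by
        rw [← Real.exp_add, add_neg_cancel, Real.exp_zero]
      calc 2 * ((k : ℝ) * (α * k * n + 1)) * Real.exp (-(b * n))
          ≤ Real.exp (b * n) * Real.exp (-(b * n)) :=
            mul_le_mul_of_nonneg_right h4 (Real.exp_pos _).le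
        _ = 1 := h5
    have hsplit : Real.exp (-(κ * n)) = Real.exp (-(b * n)) * Real.exp (-(c₁ * n)) := by
      rw [← Real.exp_add, hb]; congr 1; ring
    calc (k : ℝ) * (m * k + 1) * Real.exp (-((τ * n) ^ 2 / (2 * ((m - m' : ℕ) : ℝ))))
        ≤ (k : ℝ) * (α * k * n + 1) * Real.exp (-(κ * n)) :=
          mul_le_mul hiii hii (Real.exp_pos _).le (by positivity)
      _ = ((k : ℝ) * (α * k * n + 1) * Real.exp (-(b * n))) * Real.exp (-(c₁ * n)) := by
          rw [hsplit]; ring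
      _ ≤ (1 / 2) * Real.exp (-(c₁ * n)) := by
          refine mul_le_mul_of_nonneg_right ?_ (Real.exp_pos _).le
          linarith
      _ = Real.exp (-(c₁ * n)) / 2 := by ring
  linarith

/-- **The conclusion of the crux above the truncation level, unconditionally.** For every `k ≥ 3`,
`α, η > 0`, every `ν > 0` with `ν > 2^{-k}(1 - α_UC(k)/α)` (`α_UC(k) = 2^k/((k²-k)·2M_k)`, the
Chao–Franco unit-clause threshold) and every `c > 0`: for all large `n` (`m = ⌊α n⌋₊`) some map `g`
(below `α_UC(k)`: the localized unit-clause rule; above: its lift from the first `⌊α' n⌋` clauses,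
`α' ↑ α_UC(k)`) is `νm`-valid at every splice point of the Bresler–Huang path and `ηn`-stable between
consecutive splice points on at least `e^{-cn}·#paths` of the path tuples. -/
theorem sissDL_conclusion (k : ℕ) (hk : 3 ≤ k) (α η ν : ℝ) (hα : 0 < α) (hη : 0 < η) (hν0 : 0 < ν)
    (hν : (1 / 2 : ℝ) ^ k * (1 - (2 : ℝ) ^ k / (((k * k - k : ℕ) : ℝ) *
      (2 * (((k : ℝ) - 2) ^ (k - 2) / ((k : ℝ) - 1) ^ (k - 1)))) / α) < ν)
    (c : ℝ) (hc : 0 < c) :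
    ∀ᶠ n : ℕ in Filter.atTop, ∀ m : ℕ, m = ⌊α * n⌋₊ →
      ∃ g : (Fin m → Fin k → Fin n × Bool) → (Fin n → Bool),
        Real.exp (-(c * n)) * Fintype.card (Fin (k + 1) → Fin m → Fin k → Fin n × Bool) ≤
        ((Finset.univ.filter fun Ψ : Fin (k + 1) → Fin m → Fin k → Fin n × Bool =>
          let P : Fin k → ℕ → Fin m → Fin k → Fin n × Bool :=
            fun r q a b => if (a : ℕ) * k + b < q then Ψ r.succ a b else Ψ r.castSucc a b
          (∀ r : Fin k, ∀ q ≤ m * k, ((Finset.univ.filter fun i : Fin m =>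
            ∀ j, g (P r q) (P r q i j).1 ≠ (P r q i j).2).card : ℝ) ≤ ν * m) ∧
          ∀ r : Fin k, ∀ q < m * k,
            (hammingDist (g (P r q)) (g (P r (q + 1))) : ℝ) ≤ η * n).card : ℝ) := by
  -- the threshold
  have hk3 : (3 : ℝ) ≤ k := by exact_mod_cast hk
  have hMk0 : (0 : ℝ) < ((k : ℝ) - 2) ^ (k - 2) / ((k : ℝ) - 1) ^ (k - 1) := by
    have h1 : (0 : ℝ) < (k : ℝ) - 1 := by linarith
    have h2 : (0 : ℝ) < (k : ℝ) - 2 := by linarith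
    positivity
  have hkk : (0 : ℝ) < ((k * k - k : ℕ) : ℝ) := by
    have h : 1 ≤ k * k - k := by
      have : k + 1 ≤ k * k := by nlinarith
      omega
    exact_mod_cast h
  obtain ⟨K, hK⟩ : ∃ K : ℝ, K = ((k * k - k : ℕ) : ℝ) *
      (2 * (((k : ℝ) - 2) ^ (k - 2) / ((k : ℝ) - 1) ^ (k - 1))) := ⟨_, rfl⟩
  have hK0 : 0 < K := by rw [hK]; positivity
  obtain ⟨αUC, hαUC⟩ : ∃ αUC : ℝ, αUC = (2 : ℝ) ^ k / K := ⟨_, rfl⟩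
  have hαUC0 : 0 < αUC := by rw [hαUC]; positivity
  rw [← hK, ← hαUC] at hν
  by_cases hlow : α * ((k * k - k : ℕ) : ℝ) * (2 * (((k : ℝ) - 2) ^ (k - 2) / ((k : ℝ) - 1) ^ (k - 1)))
      < (2 : ℝ) ^ k
  · exact sissU_conclusion_of_threshold k hk α η ν hα hlow hη hν0 c hc
  · -- `α ≥ α_UC(k)`: lift from a density just below the threshold
    have hge : αUC ≤ α := by
      rw [hαUC, div_le_iff₀ hK0]
      push Not at hlow
      rw [hK, ← mul_assoc]
      exact hlow
    set p : ℝ := (1 / 2 : ℝ) ^ k with hp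
    have hp0 : 0 < p := by rw [hp]; positivity
    obtain ⟨gap, hgap⟩ : ∃ gap : ℝ, gap = ν - p * (1 - αUC / α) := ⟨_, rfl⟩
    have hgap0 : 0 < gap := by rw [hgap]; linarith
    have hgapα : gap * α = ν * α - p * (α - αUC) := by
      rw [hgap]; field_simp
    obtain ⟨ε₁, hε₁⟩ : ∃ ε₁ : ℝ, ε₁ = min (αUC / 2) (gap * α / (3 * p)) := ⟨_, rfl⟩
    have hε₁0 : 0 < ε₁ := by rw [hε₁]; positivity
    have hε₁a : ε₁ ≤ αUC / 2 := by rw [hε₁]; exact min_le_left _ _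
    have hε₁b : ε₁ ≤ gap * α / (3 * p) := by rw [hε₁]; exact min_le_right _ _
    have hε₁b' : p * ε₁ ≤ gap * α / 3 := by
      have := (le_div_iff₀ (by positivity : (0 : ℝ) < 3 * p)).1 hε₁b
      linarith
    obtain ⟨α', hα'⟩ : ∃ α' : ℝ, α' = αUC - ε₁ := ⟨_, rfl⟩
    have hα'0 : 0 < α' := by rw [hα']; linarith
    have hα'UC : α' < αUC := by rw [hα']; linarith
    have hα'α : α' < α := lt_of_lt_of_le hα'UC hge
    have hα'thr : α' * ((k * k - k : ℕ) : ℝ) *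
        (2 * (((k : ℝ) - 2) ^ (k - 2) / ((k : ℝ) - 1) ^ (k - 1))) < (2 : ℝ) ^ k := by
      rw [mul_assoc, ← hK]
      have : α' * K < αUC * K := mul_lt_mul_of_pos_right hα'UC hK0
      rw [hαUC, div_mul_cancel₀ _ hK0.ne'] at this
      exact this
    obtain ⟨ν', hν'⟩ : ∃ ν' : ℝ, ν' = gap / 3 := ⟨_, rfl⟩
    have hν'0 : 0 < ν' := by rw [hν']; positivity
    have hcond : ν' * α' + (1 / 2 : ℝ) ^ k * (α - α') < ν * α := by
      rw [← hp]
      have h1 : ν' * α' ≤ ν' * α := mul_le_mul_of_nonneg_left hα'α.le hν'0.le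
      have h2 : p * (α - α') = p * (α - αUC) + p * ε₁ := by rw [hα']; ring
      have h3 : ν' * α = gap * α / 3 := by rw [hν']; ring
      nlinarith [h1, h2, h3, hε₁b', hgapα, hgap0, hα]
    exact sissDL_transfer k α' α η ν' ν hα'0 hα'α hη hν'0.le hcond
      (fun c' hc' => sissU_conclusion_of_threshold k hk α' η ν' hα'0 hα'thr hη hν'0 c' hc') c hc

/-- **The crux off the new core region.** For every `k ≥ 3` and `α, η, ν > 0` with `α` below the
unit-clause threshold (`α·(k²-k)·2M_k < 2^k`), or `α ≥ 2^k log 2`, or `η ≥ 1`, or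
`ν > 2^{-k}(1 - α_UC(k)/α)`, the implication of `SolvableImpliesStableSection` at `(k, α, η, ν)` holds. -/
theorem sissDL_solvableImpliesStableSection_off_core (k : ℕ) (hk : 3 ≤ k) (α η ν : ℝ) (hα : 0 < α)
    (hη : 0 < η) (hν : 0 < ν)
    (hoff : α * ((k * k - k : ℕ) : ℝ) * (2 * (((k : ℝ) - 2) ^ (k - 2) / ((k : ℝ) - 1) ^ (k - 1))) < (2 : ℝ) ^ k ∨
      (2 : ℝ) ^ k * Real.log 2 ≤ α ∨ 1 ≤ η ∨
      (1 / 2 : ℝ) ^ k * (1 - (2 : ℝ) ^ k / (((k * k - k : ℕ) : ℝ) *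
        (2 * (((k : ℝ) - 2) ^ (k - 2) / ((k : ℝ) - 1) ^ (k - 1)))) / α) < ν)
    (hsolv : ∃ f : List Bool → List Bool, Literature.Computability.Complexity.IsPolyTime f ∧
      ∃ ε : ℝ, 0 < ε ∧ ∃ᶠ n : ℕ in Filter.atTop, ∀ m : ℕ, m = ⌊α * n⌋₊ → ε ≤
        ((Finset.univ.filter fun Φ : Fin m → Fin k → Fin n × Bool => ∀ i, ∃ j,
          (f (Literature.Computability.Complexity.encodingCNF.encode (List.ofFn fun a =>
            List.ofFn fun b => (((Φ a b).1 : ℕ), (Φ a b).2)))).getD (Φ i j).1 false =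
              (Φ i j).2).card : ℝ) / Fintype.card (Fin m → Fin k → Fin n × Bool))
    (c : ℝ) (hc : 0 < c) :
    ∃ᶠ n : ℕ in Filter.atTop, ∀ m : ℕ, m = ⌊α * n⌋₊ →
      ∃ g : (Fin m → Fin k → Fin n × Bool) → (Fin n → Bool),
        Real.exp (-(c * n)) * Fintype.card (Fin (k + 1) → Fin m → Fin k → Fin n × Bool) ≤
        ((Finset.univ.filter fun Ψ : Fin (k + 1) → Fin m → Fin k → Fin n × Bool =>
          let P : Fin k → ℕ → Fin m → Fin k → Fin n × Bool :=
            fun r q a b => if (a : ℕ) * k + b < q then Ψ r.succ a b else Ψ r.castSucc a b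
          (∀ r : Fin k, ∀ q ≤ m * k, ((Finset.univ.filter fun i : Fin m =>
            ∀ j, g (P r q) (P r q i j).1 ≠ (P r q i j).2).card : ℝ) ≤ ν * m) ∧
          ∀ r : Fin k, ∀ q < m * k,
            (hammingDist (g (P r q)) (g (P r (q + 1))) : ℝ) ≤ η * n).card : ℝ) := by
  rcases hoff with hUC | hlog | hη1 | hνD
  · exact sissU_solvableImpliesStableSection_off_core k hk α η ν hα hη hν (Or.inl hUC) hsolv c hc
  · exact sissU_solvableImpliesStableSection_off_core k hk α η ν hα hη hν (Or.inr (Or.inl hlog)) hsolv c hc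
  · exact sissU_solvableImpliesStableSection_off_core k hk α η ν hα hη hν
      (Or.inr (Or.inr (Or.inl hη1))) hsolv c hc
  · exact (sissDL_conclusion k hk α η ν hα hη hν hνD c hc).frequently

/-- **The crux is equivalent to its new core.** `SolvableImpliesStableSection` holds iff it holds for
every `k ≥ 3` and `α, η, ν > 0` INSIDE the core region `2^k ≤ α·(k²-k)·2M_k` (`α ≥ α_UC(k)`),
`α < 2^k log 2`, `η < 1`, `ν ≤ 2^{-k}(1 - α_UC(k)/α)`; off the core it is the theorem
`sissDL_solvableImpliesStableSection_off_core`. -/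
theorem sissDL_solvableImpliesStableSection_iff_core :
    Summit.PneNP.PneNP.Theses.OverlapGapAlgebra.SolvableImpliesStableSection ↔
    (∀ k : ℕ, 3 ≤ k → ∀ α η ν : ℝ, 0 < α → 0 < η → 0 < ν →
      (2 : ℝ) ^ k ≤ α * ((k * k - k : ℕ) : ℝ) * (2 * (((k : ℝ) - 2) ^ (k - 2) / ((k : ℝ) - 1) ^ (k - 1))) →
      α < (2 : ℝ) ^ k * Real.log 2 → η < 1 →
      ν ≤ (1 / 2 : ℝ) ^ k * (1 - (2 : ℝ) ^ k / (((k * k - k : ℕ) : ℝ) *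
        (2 * (((k : ℝ) - 2) ^ (k - 2) / ((k : ℝ) - 1) ^ (k - 1)))) / α) →
      (∃ f : List Bool → List Bool, Literature.Computability.Complexity.IsPolyTime f ∧ ∃ ε : ℝ, 0 < ε ∧ ∃ᶠ n : ℕ in Filter.atTop, ∀ m : ℕ, m = ⌊α * n⌋₊ → ε ≤ ((Finset.univ.filter fun Φ : Fin m → Fin k → Fin n × Bool => ∀ i, ∃ j, (f (Literature.Computability.Complexity.encodingCNF.encode (List.ofFn fun a => List.ofFn fun b => (((Φ a b).1 : ℕ), (Φ a b).2)))).getD (Φ i j).1 false = (Φ i j).2).card : ℝ) / Fintype.card (Fin m → Fin k → Fin n × Bool)) →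
      ∀ c : ℝ, 0 < c → ∃ᶠ n : ℕ in Filter.atTop, ∀ m : ℕ, m = ⌊α * n⌋₊ → ∃ g : (Fin m → Fin k → Fin n × Bool) → (Fin n → Bool), Real.exp (-(c * n)) * Fintype.card (Fin (k + 1) → Fin m → Fin k → Fin n × Bool) ≤ ((Finset.univ.filter fun Ψ : Fin (k + 1) → Fin m → Fin k → Fin n × Bool => let P : Fin k → ℕ → Fin m → Fin k → Fin n × Bool := fun r q a b => if (a : ℕ) * k + b < q then Ψ r.succ a b else Ψ r.castSucc a b; (∀ r : Fin k, ∀ q ≤ m * k, ((Finset.univ.filter fun i : Fin m => ∀ j, g (P r q) (P r q i j).1 ≠ (P r q i j).2).card : ℝ) ≤ ν * m) ∧ ∀ r : Fin k, ∀ q < m * k, (hammingDist (g (P r q)) (g (P r (q + 1))) : ℝ) ≤ η * n).card : ℝ)) := by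
  constructor
  · intro h k hk α η ν hα hη hν _ _ _ _ hsolv c hc
    exact h k hk α η ν hα hη hν hsolv c hc
  · intro hcore
    unfold Summit.PneNP.PneNP.Theses.OverlapGapAlgebra.SolvableImpliesStableSection
    intro k hk α η ν hα hη hν hsolv c hc
    by_cases h1 : (2 : ℝ) ^ k ≤ α * ((k * k - k : ℕ) : ℝ) * (2 * (((k : ℝ) - 2) ^ (k - 2) / ((k : ℝ) - 1) ^ (k - 1)))
    · by_cases h2 : α < (2 : ℝ) ^ k * Real.log 2
      · by_cases h3 : η < 1
        · by_cases h4 : ν ≤ (1 / 2 : ℝ) ^ k * (1 - (2 : ℝ) ^ k / (((k * k - k : ℕ) : ℝ) *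
              (2 * (((k : ℝ) - 2) ^ (k - 2) / ((k : ℝ) - 1) ^ (k - 1)))) / α)
          · exact hcore k hk α η ν hα hη hν h1 h2 h3 h4 hsolv c hc
          · exact sissDL_solvableImpliesStableSection_off_core k hk α η ν hα hη hν
              (Or.inr (Or.inr (Or.inr (not_le.1 h4)))) hsolv c hc
        · exact sissDL_solvableImpliesStableSection_off_core k hk α η ν hα hη hν
            (Or.inr (Or.inr (Or.inl (not_lt.1 h3)))) hsolv c hc
      · exact sissDL_solvableImpliesStableSection_off_core k hk α η ν hα hη hν
          (Or.inr (Or.inl (not_lt.1 h2))) hsolv c hc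
    · exact sissDL_solvableImpliesStableSection_off_core k hk α η ν hα hη hν
        (Or.inl (not_le.1 h1)) hsolv c hc

end DensityLiftAssembly

end Summit.PneNP.PneNP.Theorems
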